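import Summits.QuantumFields.YangMills.Theorems.LuscherReductionTwistedTraceScalingInnerModelPerturbed
import Summits.QuantumFields.YangMills.Theorems.LuscherReductionTwistedTraceScalingInnerKernelComparisonTail
import HarnessLib

/-!
# C4 INNER, brick O′⁺: the model blocks for a true kernel that is only REGIONALLY near the tensor model, with an absolute tail — `|K₂ − k⊗K| ≤ η·k⊗K + τ`
# (lane A of S-BASE, crux `TwistedTraceScaling` stmt-QuantumFields-20203; sub-target C4-CORE; design note `pub/ym-fleet/ym-luscher-20007-p1/COARSE-DESIGN.md` §22.7)

Brick O′ (`…InnerModelPerturbed`: `true_boOrth_le`, `true_boProj_boOrth`, `true_boProj_boProj`) assumed the GLOBAL relative bound `|K₂ − k⊗K| ≤ η·k⊗K`, which the disprover's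
rigidity theorems (`Theorems/TwistedTraceScaling/Negative/ModelPerturbedNearRigidity.lean`, `…NearRegional.lean`) show to be unattainable for a c-dependent stiff Gaussian.
With D0⁺ (`…InnerKernelComparisonTail`, `L¹`-tail form, valid on the infinite model space `C × ℝ^σ`) the three blocks are re-derived under the attainable hypothesis
`|K₂ − k⊗K| ≤ η·k⊗K + τ` (relative on the bulk, absolute `τ` off it — a single pointwise inequality), at the price of the additive terms `τ·‖·‖₁·‖·‖₁` (paid in
applications by the bounded support of the test functions and the Gaussian smallness of `τ`):
★★ `true_boOrth_le_add`, ★★ `true_boProj_boOrth_add`, ★★ `true_boProj_boProj_add`.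
HONEST FRAMING: bookkeeping on top of O′/D0⁺; a brick of C4-CORE of the CONDITIONAL reduction route R2b1; not infinite volume, not a gap, not Clay.
-/

set_option autoImplicit false

noncomputable section

open MeasureTheory Filter Topology
open scoped Real

namespace Summit.QuantumFields.YangMills.Theorems.FemtoTransferGap.Mehler

open Literature.Analysis.SegalBargmann Literature.Analysis.OperatorTheory KernelComparison

section

variable {C : Type*} [MeasurableSpace C] {ν : Measure C} [SFinite ν]
variable {σ : Type*} [Fintype σ] [DecidableEq σ]
variable {k : C → C → ℝ} {a b : σ → ℝ} {μ₁ ρ η τ : ℝ} {K₂ : (C × (σ → ℝ)) → (C × (σ → ℝ)) → ℝ}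

/-- ★★ **STIFF block, regional nearness + tail**: `T₂(Φ−PΦ, Φ−PΦ) ≤ (λ₀ρ + ηM)μ₁‖Φ−PΦ‖₂² + τ‖Φ−PΦ‖₁²`. [cite: Luscher1983, §3] [cite: Helffer2013, Lemma 7.1] -/
theorem true_boOrth_le_add (ha : ∀ i, 0 < a i) (hb : ∀ i, 0 < b i) (hab : ∀ i, a i ^ 2 + 2 * a i * b i = π ^ 2)
    (hρ0 : 0 ≤ ρ) (hρ : ∀ i, b i / (a i + b i + π) ≤ ρ) (hρ1 : ρ ≤ 1) (hη : 0 ≤ η)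
    (hk0 : ∀ c c', 0 ≤ k c c') (hksymm : ∀ c c', k c c' = k c' c) (hkm : Measurable (Function.uncurry k))
    (hkint : ∀ c, Integrable (k c) ν) (hμ₁ : 0 ≤ μ₁) (hkrow : ∀ c, ∫ c', k c c' ∂ν ≤ μ₁)
    (hK₂m : Measurable (Function.uncurry K₂)) (hnear : ∀ x x', |K₂ x x' - 1 * tensorKernel k a b x x'| ≤ η * 1 * tensorKernel k a b x x' + τ)
    {Φ : C × (σ → ℝ) → ℝ} (hΦ : MemLp Φ 2 (ν.prod volume)) (hO1 : Integrable (boOrth Φ) (ν.prod volume)) :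
    ∫ x, ∫ x', boOrth Φ x * K₂ x x' * boOrth Φ x' ∂(ν.prod volume) ∂(ν.prod volume) ≤
      ((∏ i, Real.sqrt (π / (a i + b i + π))) * ρ + η * ∏ i, Real.sqrt (π / a i)) * μ₁ * ∫ x, boOrth Φ x ^ 2 ∂(ν.prod volume)
        + τ * (∫ x, |boOrth Φ x| ∂(ν.prod volume)) ^ 2 := by
  have hO := memLp_boOrth hΦ
  obtain ⟨h0, hsy, hrow, hu2, -, hmeas, hIabs, hI, hI1, hI2⟩ := tensor_comparison_data ha hb hk0 hksymm hkm hkint hkrow hK₂m hO hO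
  have hM : 0 ≤ μ₁ * ∏ i, Real.sqrt (π / a i) := mul_nonneg hμ₁ (Finset.prod_nonneg fun i _ => Real.sqrt_nonneg _)
  have h1 := abs_le.mp (abs_form_sub_le_of_kernel_near_add_L1 (ν := ν.prod volume) zero_le_one hη hM h0 hsy hrow hnear hu2 hO1 hmeas hIabs hI hI1 hI2)
  have h2 := tensorForm_boOrth_le ha hb hab hρ0 hρ hρ1 hk0 hksymm hkm hkint hμ₁ hkrow hΦ
  rw [tensorForm_eq] at h2
  have h3 := h1.2
  rw [one_mul, mul_one] at h3
  have : (∫ x, ∫ x', boOrth Φ x * tensorKernel k a b x x' * boOrth Φ x' ∂(ν.prod volume) ∂(ν.prod volume)) +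
      η * (μ₁ * ∏ i, Real.sqrt (π / a i)) * ∫ x, boOrth Φ x ^ 2 ∂(ν.prod volume) ≤
      ((∏ i, Real.sqrt (π / (a i + b i + π))) * ρ + η * ∏ i, Real.sqrt (π / a i)) * μ₁ * ∫ x, boOrth Φ x ^ 2 ∂(ν.prod volume) := by
    nlinarith [h2]
  linarith

/-- ★★ **OFF-DIAGONAL block, regional nearness + tail**: `|T₂(PΦ, Ψ−PΨ)| ≤ ημ₁M‖PΦ‖₂‖Ψ−PΨ‖₂ + τ‖PΦ‖₁‖Ψ−PΨ‖₁`. [cite: Luscher1983, §3] [cite: Helffer2013, Lemma 7.1] -/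
theorem true_boProj_boOrth_add (ha : ∀ i, 0 < a i) (hb : ∀ i, 0 < b i) (hab : ∀ i, a i ^ 2 + 2 * a i * b i = π ^ 2) (hη : 0 ≤ η)
    (hk0 : ∀ c c', 0 ≤ k c c') (hksymm : ∀ c c', k c c' = k c' c) (hkm : Measurable (Function.uncurry k))
    (hkint : ∀ c, Integrable (k c) ν) (hμ₁ : 0 ≤ μ₁) (hkrow : ∀ c, ∫ c', k c c' ∂ν ≤ μ₁)
    (hK₂m : Measurable (Function.uncurry K₂)) (hnear : ∀ x x', |K₂ x x' - 1 * tensorKernel k a b x x'| ≤ η * 1 * tensorKernel k a b x x' + τ)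
    {Φ Ψ : C × (σ → ℝ) → ℝ} (hΦ : MemLp Φ 2 (ν.prod volume)) (hΨ : MemLp Ψ 2 (ν.prod volume))
    (hP1 : Integrable (boProj Φ) (ν.prod volume)) (hO1 : Integrable (boOrth Ψ) (ν.prod volume)) :
    |∫ x, ∫ x', boProj Φ x * K₂ x x' * boOrth Ψ x' ∂(ν.prod volume) ∂(ν.prod volume)| ≤
      η * (μ₁ * ∏ i, Real.sqrt (π / a i)) * (Real.sqrt (∫ x, boProj Φ x ^ 2 ∂(ν.prod volume)) * Real.sqrt (∫ x, boOrth Ψ x ^ 2 ∂(ν.prod volume)))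
        + τ * ((∫ x, |boProj Φ x| ∂(ν.prod volume)) * ∫ x, |boOrth Ψ x| ∂(ν.prod volume)) := by
  have hP := memLp_boProj hΦ
  have hO := memLp_boOrth hΨ
  obtain ⟨h0, hsy, hrow, hu2, hw2, hmeas, hIabs, hI, hI1, hI2⟩ := tensor_comparison_data ha hb hk0 hksymm hkm hkint hkrow hK₂m hP hO
  have hM : 0 ≤ μ₁ * ∏ i, Real.sqrt (π / a i) := mul_nonneg hμ₁ (Finset.prod_nonneg fun i _ => Real.sqrt_nonneg _)
  have h1 := abs_bilin_sub_le_of_kernel_near_add_L1 (ν := ν.prod volume) zero_le_one hη hM h0 hsy hrow hnear hu2 hw2 hP1 hO1 hmeas hIabs hI hI1 hI2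
  have h2 := tensorForm_boProj_boOrth ha hb hab hk0 hksymm hkm hkint hμ₁ hkrow hΦ hΨ
  rw [tensorForm_eq] at h2
  rw [h2, mul_zero, sub_zero, mul_one] at h1
  exact h1

/-- ★★ **DIAGONAL block, regional nearness + tail**: `|T₂(PΦ,PΦ) − λ₀∫∫φ₀kφ₀| ≤ ημ₁M‖PΦ‖₂² + τ‖PΦ‖₁²`. [cite: Luscher1983, §3] [cite: Helffer2013, Lemma 7.1] -/
theorem true_boProj_boProj_add (ha : ∀ i, 0 < a i) (hb : ∀ i, 0 < b i) (hab : ∀ i, a i ^ 2 + 2 * a i * b i = π ^ 2) (hη : 0 ≤ η)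
    (hk0 : ∀ c c', 0 ≤ k c c') (hksymm : ∀ c c', k c c' = k c' c) (hkm : Measurable (Function.uncurry k))
    (hkint : ∀ c, Integrable (k c) ν) (hμ₁ : 0 ≤ μ₁) (hkrow : ∀ c, ∫ c', k c c' ∂ν ≤ μ₁)
    (hK₂m : Measurable (Function.uncurry K₂)) (hnear : ∀ x x', |K₂ x x' - 1 * tensorKernel k a b x x'| ≤ η * 1 * tensorKernel k a b x x' + τ)
    {Φ : C × (σ → ℝ) → ℝ} (hΦ : MemLp Φ 2 (ν.prod volume)) (hP1 : Integrable (boProj Φ) (ν.prod volume)) :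
    |(∫ x, ∫ x', boProj Φ x * K₂ x x' * boProj Φ x' ∂(ν.prod volume) ∂(ν.prod volume)) -
        (∏ i, Real.sqrt (π / (a i + b i + π))) * ∫ c, ∫ c', slowCoeff Φ c * k c c' * slowCoeff Φ c' ∂ν ∂ν| ≤
      η * (μ₁ * ∏ i, Real.sqrt (π / a i)) * ∫ x, boProj Φ x ^ 2 ∂(ν.prod volume) + τ * (∫ x, |boProj Φ x| ∂(ν.prod volume)) ^ 2 := by
  have hP := memLp_boProj hΦ
  obtain ⟨h0, hsy, hrow, hu2, -, hmeas, hIabs, hI, hI1, hI2⟩ := tensor_comparison_data ha hb hk0 hksymm hkm hkint hkrow hK₂m hP hP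
  have hM : 0 ≤ μ₁ * ∏ i, Real.sqrt (π / a i) := mul_nonneg hμ₁ (Finset.prod_nonneg fun i _ => Real.sqrt_nonneg _)
  have h1 := abs_form_sub_le_of_kernel_near_add_L1 (ν := ν.prod volume) zero_le_one hη hM h0 hsy hrow hnear hu2 hP1 hmeas hIabs hI hI1 hI2
  have h2 := tensorForm_boProj_boProj ha hb hab hk0 hksymm hkm hkint hμ₁ hkrow hΦ hΦ
  rw [tensorForm_eq] at h2
  rw [h2, one_mul, mul_one] at h1
  exact h1

end

end Summit.QuantumFields.YangMills.Theorems.FemtoTransferGap.Mehler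

end
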